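import Mathlib
import HarnessLib
import Summits.AtomisticToContinuum.FouriersLaw.Theses.HoelderEscapeProfile
import Summits.AtomisticToContinuum.FouriersLaw.Theorems.HoelderEscapeProfileLocalEnergyHalfHoelderStubStaticRiesz
import Summits.AtomisticToContinuum.FouriersLaw.Theorems.HoelderEscapeProfileLocalEnergyHalfHoelderStubPulseBounded
import Summits.AtomisticToContinuum.FouriersLaw.Theorems.HoelderEscapeProfileLocalEnergyHalfHoelderStubHydroBound
import Summits.AtomisticToContinuum.FouriersLaw.Theorems.HoelderEscapeProfileLocalEnergyHalfHoelderStubNormalEqSolvable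
import Summits.AtomisticToContinuum.FouriersLaw.Theorems.HoelderEscapeProfileLocalEnergyHalfHoelderStubDyadicAbel
import Summits.AtomisticToContinuum.FouriersLaw.Theorems.HoelderEscapeProfileLocalEnergyHalfHoelderStubDoublingIdentity
import Summits.AtomisticToContinuum.FouriersLaw.Theorems.HoelderEscapeProfileLocalEnergyHalfHoelderStubPulseMomentGuard
import Summits.AtomisticToContinuum.FouriersLaw.Theorems.HoelderEscapeProfileLocalEnergyHalfHoelderStubPulseDissipationCalculus
import Summits.AtomisticToContinuum.FouriersLaw.Theorems.HoelderEscapeProfileLocalEnergyHalfHoelderStubNashL2Decay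

/-!
# Line `Sketch` (crux idea `nash-doubling-debris`) — NASH WITHOUT CHAPMAN–KOLMOGOROV for the return of the local energy
(crux `HoelderEscapeProfile.LocalEnergyHalfHoelder`, item `stmt-AtomisticToContinuum-16008`,
route `route-AtomisticToContinuum-HoelderEscapeProfile`, rank 2; lead `prover-line-stmt-AtomisticToContinuum-16008-0`, 2026-08-17,
continued by `prover-line-stmt-AtomisticToContinuum-16008-c1-0`; skeleton OWNED by the lead, built from the card `Cruxes/LocalEnergyHalfHoelder/Ideas/nash-doubling-debris.md` and the ideator's
Sketch.lean of 2026-08-17T10:56:38Z)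

Crux (FIXED, concluded BY NAME below): for the guarded infinite pinned chain `(μ, D)` at temperature `T` and the split-bond site
energy `h`, with `S x t = Cov_μ(h_0, h_x∘φ_t)`: `Ψ(ν) := ν∫₀^∞ e^{-νt} S(0,t) dt ≤ C√ν` for `0 < ν ≤ ν₀`.

## The lever: the time-reversal DOUBLING IDENTITY replaces the semigroup property in Nash's L² → L^∞ step

For the `μ`-preserving flow, `S(0,2t) = ⟨h̃₀∘φ₋ₜ, h̃₀∘φₜ⟩_{L²(μ)}`; splitting both vectors with the orthogonal projection `P_L`
onto `span{h̃ₓ : |x| ≤ L}` (finite normal equations `S(−y,t) = Σₓ apₓ S(x−y,0)`, Gram matrix `S(x−y,0) = Cov(hₓ,h_y)`) gives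
`S(0,2t) = Σₓ apₓ S(x,t) + R_L(t)` with `R_L(t) = ⟨(1−P_L)h̃₀∘φ₋ₜ, (1−P_L)h̃₀∘φₜ⟩` the DEBRIS term, and two Cauchy–Schwarz steps
in the Gram metric bound the hydrodynamic term by `χ_min⁻¹ Σ_{|x|≤L} S(x,t)²` as soon as `Var(Σ aₓhₓ) ≥ χ_min Σ aₓ²`
(here `χ_min = T²/2`, from the Maxwellian momenta).  Hence the doubling recursion
`S(0,2s) ≤ χ_min⁻¹ Σₓ S(x,s)² + R_L(s) ≤ χ_min⁻¹ B/√s + c·S(0,s)` (PulseL2Decay + DebrisRelativeBound), and the dyadic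
Abelian lemma turns it into `Ψ(ν) ≤ C√ν` because `c < 2^{-1/2}`.

## Stubs (state after the continuation lead's reshape, 2026-08-17 c1: 9 LANDED + 2 ACTIVE; `LocalEnergyHalfHoelder_of` sorry-free)

LANDED (imported from `Theorems/HoelderEscapeProfileLocalEnergyHalfHoelderStub*.lean`, all kernel-closed, standard axioms):
`stub_staticRiesz` (p159348), `stub_pulseBounded` (p158914), `stub_hydroBound` (p158793), `stub_normalEqSolvable` (p158724),
`stub_dyadicAbel` (p158946), `stub_doublingIdentity` (p160767), `stub_pulseMomentGuard` (p160799),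
`stub_pulseDissipationCalculus` (p161707 — VERBATIM the registered stub of crux LinearSpread stmt-15382, proved for EVERY admissible `D`),
`stub_nashL2Decay` (p160715).
ACTIVE (the line is CLOSED MODULO exactly these two named dynamical statements; both are decay statements for the
infinite-volume deterministic anharmonic chain at equilibrium, for which no tool exists in tree or in print — census §Decomposition (iv)):
* `stub_pulseL2Decay`        — `∃ B t₁, ∀ t ≥ t₁, ∀ L, Σ_{|x|≤L}S(x,t)² ≤ B/√t` (the pulse's `ℓ²` norm decays at the sharp
  diffusive rate). RESHAPE of this pass: it REPLACES the registered `stub_globalCoercivity` (pointwise response coercivity =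
  LinearSpread's stub), of which it is a strict weakening — the bridge `stub_pulseL2Decay_of_globalCoercivity` (coercivity ⇒
  ℓ²-decay via the landed guard + dissipation calculus + Nash lemma) is PROVED below, so a proof of LinearSpread's stub still
  closes it by `exact`; it no longer asks `t ↦ ΣₓS(x,t)²` to be monotone at every late time.
* `stub_debrisRelativeBound` — hardest, held by the lead: the debris of the doubling identity is `≤ c·S(0,s)`, `c < 2^{-1/2}`,
  for `s ≥ s₁` and all large windows. Fibrewise `R_∞(s) = (1/2π)∫χ(k)[φ_{2s}(k) − φ_s(k)²]dk` (k-averaged Markov defect of the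
  energy modes, `φ_s(k) = Ŝ(k,s)/χ(k)`); unitarity alone puts NO constraint on it (every positive-definite `φ·(k)` with `φ₀ = 1`
  is realised by some unitary dilation — Naimark), so the stub is a genuine statement about the fibre spectral measures `σ̃_k`
  of the chain: crux-sized (the census's K1₀ wall re-sited onto `(1−P)L²(μ)`).

Disproof used: `Cruxes/LocalEnergyHalfHoelder/Disproof.lean` (cdisprove cycle 1): NO KILL; load-bearing = DLR (two-site
content) + `PreservesMeasure` — both enter here (`staticRiesz` uses the Maxwellian conditional structure across sites,
`pulseBounded`/`doublingIdentity` use preservation); the uniform-oscillation arena (not Gibbs) has a singular Gram matrix and is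
outside `staticRiesz`; the frozen flow makes `stub_pulseL2Decay` false and the line silent (`no_frozen_dynamics`); hot-lump
threat (`SlowTailExcluded`): a tail `S(0,t) ≥ a t^{-α}` with `α < ½` falsifies K1 itself, and falsifies `stub_pulseL2Decay`
as well once `α < ¼` (`ΣₓS(x,t)² ≥ S(0,t)² ≥ a²t^{-2α}`); Targets: none posted for this line's stubs yet.
-/

noncomputable section

open MeasureTheory

namespace Summit.AtomisticToContinuum.FouriersLaw.Cruxes.LocalEnergyHalfHoelder

namespace NashDoubling

/-! ## The declared stub STATEMENTS (`Stmt.stub_…`, matched BY NAME to the stubs below) -/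

/-- **stub `stub_staticRiesz` (STATIC) — LANDED p159348.** Uniform strict positive-definiteness of the energy covariance with the explicit constant χ_min = T²/2 (Maxwellian momenta): `(T²/2)Σaₓ² ≤ ΣₓΣ_y aₓa_y S(y−x,0) = Var_μ(Σ aₓhₓ)`. -/
abbrev Stmt.stub_staticRiesz : Prop :=
    ∀ ω₂ lam β γ : ℝ, 0 < ω₂ → 0 < lam → 0 < β → ∀ T : ℝ, 0 < T → ∀ μ : MeasureTheory.Measure Literature.MathematicalPhysics.KineticTheory.HeatConduction.ChainConfig, (Literature.MathematicalPhysics.KineticTheory.HeatConduction.pinnedChain ω₂ lam β γ).IsChainGibbsMeasure T μ → Literature.MathematicalPhysics.KineticTheory.HeatConduction.IsShiftInvariant μ → μ.map (fun σ : Literature.MathematicalPhysics.KineticTheory.HeatConduction.ChainConfig => fun x : ℤ => ((σ x).1, -(σ x).2)) = μ → ∀ D : Literature.MathematicalPhysics.KineticTheory.HeatConduction.InfiniteChainDynamics (Literature.MathematicalPhysics.KineticTheory.HeatConduction.pinnedChain ω₂ lam β γ), D.PreservesMeasure μ → (∀ t : ℝ, ∀ᵐ σ ∂μ, D.flow t (Literature.MathematicalPhysics.KineticTheory.HeatConduction.shift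 σ) = Literature.MathematicalPhysics.KineticTheory.HeatConduction.shift (D.flow t σ)) → ∀ h : Literature.MathematicalPhysics.KineticTheory.HeatConduction.ChainConfig → ℤ → ℝ, h = (fun (σ : Literature.MathematicalPhysics.KineticTheory.HeatConduction.ChainConfig) (x : ℤ) => (σ x).2 ^ 2 / 2 + (Literature.MathematicalPhysics.KineticTheory.HeatConduction.pinnedChain ω₂ lam β γ).U (σ x).1 + ((Literature.MathematicalPhysics.KineticTheory.HeatConduction.pinnedChain ω₂ lam β γ).V ((σ (x + 1)).1 - (σ x).1) + (Literature.MathematicalPhysics.KineticTheory.HeatConduction.pinnedChain ω₂ lam β γ).V ((σ x).1 - (σ (x - 1)).1)) / 2) → ∀ S : ℤ → ℝ → ℝ, S = (fun (x : ℤ) (t : ℝ) => ∫ σ, (h σ 0 - ∫ σ', h σ' 0 ∂μ) * (h (D.flow t σ) x - ∫ σ', h σ' 0 ∂μ) ∂μ) → (∀ ν : ℝ, 0 < ν → MeasureTheory.IntegrableOn (fun t : ℝ => Real.exp (-(ν * t)) * S 0 t) (Set.Ioi 0)) → ∀ (L : ℕ) (a : ℤ → ℝ), T ^ 2 / 2 *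 ∑ x ∈ Finset.Icc (-(L:ℤ)) (L:ℤ), a x ^ 2 ≤ ∑ x ∈ Finset.Icc (-(L:ℤ)) (L:ℤ), ∑ y ∈ Finset.Icc (-(L:ℤ)) (L:ℤ), a x * a y * S (y - x) 0

/-- **stub `stub_pulseBounded` — LANDED p158914.** `|S(x,t)| ≤ V` (`V = Var h₀`; Cauchy–Schwarz + preservation). -/
abbrev Stmt.stub_pulseBounded : Prop :=
    ∀ ω₂ lam β γ : ℝ, 0 < ω₂ → 0 < lam → 0 < β → ∀ T : ℝ, 0 < T → ∀ μ : MeasureTheory.Measure Literature.MathematicalPhysics.KineticTheory.HeatConduction.ChainConfig, (Literature.MathematicalPhysics.KineticTheory.HeatConduction.pinnedChain ω₂ lam β γ).IsChainGibbsMeasure T μ → Literature.MathematicalPhysics.KineticTheory.HeatConduction.IsShiftInvariant μ → μ.map (fun σ : Literature.MathematicalPhysics.KineticTheory.HeatConduction.ChainConfig => fun x : ℤ => ((σ x).1, -(σ x).2)) = μ → ∀ D : Literature.MathematicalPhysics.KineticTheory.HeatConduction.InfiniteChainDynamics (Literature.MathematicalPhysics.KineticTheory.HeatConduction.pinnedChain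 ω₂ lam β γ), D.PreservesMeasure μ → (∀ t : ℝ, ∀ᵐ σ ∂μ, D.flow t (Literature.MathematicalPhysics.KineticTheory.HeatConduction.shift σ) = Literature.MathematicalPhysics.KineticTheory.HeatConduction.shift (D.flow t σ)) → ∀ h : Literature.MathematicalPhysics.KineticTheory.HeatConduction.ChainConfig → ℤ → ℝ, h = (fun (σ : Literature.MathematicalPhysics.KineticTheory.HeatConduction.ChainConfig) (x : ℤ) => (σ x).2 ^ 2 / 2 + (Literature.MathematicalPhysics.KineticTheory.HeatConduction.pinnedChain ω₂ lam β γ).U (σ x).1 + ((Literature.MathematicalPhysics.KineticTheory.HeatConduction.pinnedChain ω₂ lam β γ).V ((σ (x + 1)).1 - (σ x).1) + (Literature.MathematicalPhysics.KineticTheory.HeatConduction.pinnedChain ω₂ lam β γ).V ((σ x).1 - (σ (x - 1)).1)) / 2) → ∀ S : ℤ → ℝ → ℝ, S = (fun (x : ℤ) (t : ℝ) => ∫ σ, (h σ 0 - ∫ σ', h σ' 0 ∂μ) * (h (D.flow t σ) x - ∫ σ', h σ' 0 ∂μ) ∂μ) → (∀ ν : ℝ, 0 < ν → MeasureTheory.IntegrableOn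 (fun t : ℝ => Real.exp (-(ν * t)) * S 0 t) (Set.Ioi 0)) → ∃ V : ℝ, ∀ (x : ℤ) (t : ℝ), |S x t| ≤ V

/-- **stub `stub_pulseL2Decay` (DYNAMICS; open) — the PULSE ℓ²-DECAY, exactly what the composition consumes on the pulse side (reshape by the continuation lead c1, 2026-08-17).** `∃ B, t₁ > 0: ∀ t ≥ t₁, ∀ L, Σ_{|x|≤L} S(x,t)² ≤ B/√t` — the `ℓ²(ℤ)`-norm of the equilibrium energy pulse decays at the sharp diffusive rate (calibration `Σₓ S² = χ²/√(8πDt)`; spectrally `(1/2π)∫χ(k)²φ_t(k)² dk`). STRICTLY WEAKER than the former registered stub `stub_globalCoercivity` (pointwise response coercivity, = LinearSpread's stub): `stub_pulseL2Decay_of_globalCoercivity` below derives it from coercivity through the LANDED moment guard, dissipation calculus and discrete Nash lemma, so a proof of LinearSpread's `stub_globalCoercivity` still closes this stub by one `exact`; but it does not ask the dissipation `−ΣF∇S` to have a sign at every late time (only the size of `ΣS²`), so it survives late-time oscillations of non-hydrodynamic fibre modes that would break pointwise coercivity. -/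
abbrev Stmt.stub_pulseL2Decay : Prop :=
    ∀ ω₂ lam β γ : ℝ, 0 < ω₂ → 0 < lam → 0 < β → ∀ T : ℝ, 0 < T → ∀ μ : MeasureTheory.Measure Literature.MathematicalPhysics.KineticTheory.HeatConduction.ChainConfig, (Literature.MathematicalPhysics.KineticTheory.HeatConduction.pinnedChain ω₂ lam β γ).IsChainGibbsMeasure T μ → Literature.MathematicalPhysics.KineticTheory.HeatConduction.IsShiftInvariant μ → μ.map (fun σ : Literature.MathematicalPhysics.KineticTheory.HeatConduction.ChainConfig => fun x : ℤ => ((σ x).1, -(σ x).2)) = μ → ∀ D : Literature.MathematicalPhysics.KineticTheory.HeatConduction.InfiniteChainDynamics (Literature.MathematicalPhysics.KineticTheory.HeatConduction.pinnedChain ω₂ lam β γ), D.PreservesMeasure μ → (∀ t : ℝ, ∀ᵐ σ ∂μ, D.flow t (Literature.MathematicalPhysics.KineticTheory.HeatConduction.shift σ) = Literature.MathematicalPhysics.KineticTheory.HeatConduction.shift (D.flow t σ)) → ∀ h : Literature.MathematicalPhysics.KineticTheory.HeatConduction.ChainConfig → ℤ → ℝ, h = (fun (σ : Literature.MathematicalPhysics.KineticTheory.HeatConduction.ChainConfig)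 (x : ℤ) => (σ x).2 ^ 2 / 2 + (Literature.MathematicalPhysics.KineticTheory.HeatConduction.pinnedChain ω₂ lam β γ).U (σ x).1 + ((Literature.MathematicalPhysics.KineticTheory.HeatConduction.pinnedChain ω₂ lam β γ).V ((σ (x + 1)).1 - (σ x).1) + (Literature.MathematicalPhysics.KineticTheory.HeatConduction.pinnedChain ω₂ lam β γ).V ((σ x).1 - (σ (x - 1)).1)) / 2) → ∀ S : ℤ → ℝ → ℝ, S = (fun (x : ℤ) (t : ℝ) => ∫ σ, (h σ 0 - ∫ σ', h σ' 0 ∂μ) * (h (D.flow t σ) x - ∫ σ', h σ' 0 ∂μ) ∂μ) → (∀ ν : ℝ, 0 < ν → MeasureTheory.IntegrableOn (fun t : ℝ => Real.exp (-(ν * t)) * S 0 t) (Set.Ioi 0)) → ∃ B t₁ : ℝ, 0 < t₁ ∧ ∀ t : ℝ, t₁ ≤ t → ∀ L : ℕ, ∑ x ∈ Finset.Icc (-(L:ℤ)) (L:ℤ), S x t ^ 2 ≤ B / Real.sqrt t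

/-- **stub `stub_hydroBound` (algebra) — LANDED p158793.** Coercive Gram form + normal equations ⇒ `Σ apₓuₓ ≤ χm⁻¹ Σuₓ²`. -/
abbrev Stmt.stub_hydroBound : Prop :=
    ∀ (L : ℕ) (G u v ap : ℤ → ℝ) (χm : ℝ), 0 < χm → (∀ a : ℤ → ℝ, χm * ∑ x ∈ Finset.Icc (-(L:ℤ)) (L:ℤ), a x ^ 2 ≤ ∑ x ∈ Finset.Icc (-(L:ℤ)) (L:ℤ), ∑ y ∈ Finset.Icc (-(L:ℤ)) (L:ℤ), a x * a y * G (y - x)) → (∀ y ∈ Finset.Icc (-(L:ℤ)) (L:ℤ), v y = ∑ x ∈ Finset.Icc (-(L:ℤ)) (L:ℤ), ap x * G (x - y)) → ∑ x ∈ Finset.Icc (-(L:ℤ)) (L:ℤ), u x ^ 2 = ∑ x ∈ Finset.Icc (-(L:ℤ)) (L:ℤ), v x ^ 2 → ∑ x ∈ Finset.Icc (-(L:ℤ)) (L:ℤ), ap x * u x ≤ χm⁻¹ * ∑ x ∈ Finset.Icc (-(L:ℤ)) (L:ℤ), u x ^ 2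

/-- **stub `stub_normalEqSolvable` (algebra) — LANDED p158724.** Coercive Gram form ⇒ the finite normal equations are solvable. -/
abbrev Stmt.stub_normalEqSolvable : Prop :=
    ∀ (L : ℕ) (G v : ℤ → ℝ) (χm : ℝ), 0 < χm → (∀ a : ℤ → ℝ, χm * ∑ x ∈ Finset.Icc (-(L:ℤ)) (L:ℤ), a x ^ 2 ≤ ∑ x ∈ Finset.Icc (-(L:ℤ)) (L:ℤ), ∑ y ∈ Finset.Icc (-(L:ℤ)) (L:ℤ), a x * a y * G (y - x)) → ∃ ap : ℤ → ℝ, ∀ y ∈ Finset.Icc (-(L:ℤ)) (L:ℤ), v y = ∑ x ∈ Finset.Icc (-(L:ℤ)) (L:ℤ), ap x * G (x - y)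

/-- **stub `stub_dyadicAbel` (real analysis) — LANDED p158946.** Bounded `f` with `f(2s) ≤ a/√s + c f(s)` (`c < 2^{-1/2}`) has Abel means `O(√ν)`. -/
abbrev Stmt.stub_dyadicAbel : Prop :=
    ∀ (f : ℝ → ℝ) (V a c s₁ : ℝ), (∀ ν : ℝ, 0 < ν → MeasureTheory.IntegrableOn (fun t : ℝ => Real.exp (-(ν * t)) * f t) (Set.Ioi 0)) → (∀ t : ℝ, 0 ≤ t → |f t| ≤ V) → 0 ≤ c → c < 1 / Real.sqrt 2 → 0 < s₁ → (∀ s : ℝ, s₁ ≤ s → f (2 * s) ≤ a / Real.sqrt s + c * f s) → ∃ C ν₀ : ℝ, 0 < ν₀ ∧ ∀ ν : ℝ, 0 < ν → ν ≤ ν₀ → ν * ∫ t in Set.Ioi (0:ℝ), Real.exp (-(ν * t)) * f t ≤ C * Real.sqrt ν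

/-- **stub `stub_doublingIdentity` (DYNAMICS, provable now; size L) — the card's first lemma `DoublingIdentityFiniteRank`.** For every time `s`, window `L`, every solution `ap` of the finite normal equations `S(−y,s) = Σₓ apₓ S(x−y,0)` (`|y| ≤ L`; i.e. `Σ apₓh̃ₓ = P_L(h̃₀∘φₛ)`) and EVERY `am`, the debris integral `∫ (h̃₀∘φ₋ₛ − Σ amₓh̃ₓ)(h̃₀∘φₛ − Σ apₓh̃ₓ) dμ` equals `S(0,2s) − Σₓ apₓ S(x,s)`. Ingredients: `h̃ₓ ∈ L²(μ)` (superstability of the shift-invariant DLR state); UNITARITY — `∫ (h̃₀∘φ₋ₛ)(h̃₀∘φₛ) dμ = S(0,2s)` and `∫ (h̃₀∘φ₋ₛ) h̃ₓ dμ = S(x,s)` by `PreservesMeasure` (substitute `σ = φₛσ'`) and the group law `φ₋ₛ∘φₛ = id`, `φₛ∘φₛ = φ₂ₛ` on the conull carrier (`flow_add`); STATIONARITY IN SPACE — `∫ h̃ₓ (h̃₀∘φₛ) dμ = S(−x,s)` and `∫ h̃ₓh̃_y dμ = S(y−x,0)` by shift invariance of `μ` and a.e. shift covariance of the flow; then bilinearity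 and ONE use of the normal equations (the `am`-cross terms cancel: `Σₓ amₓ[S(−x,s) − Σ_y ap_y S(y−x,0)] = 0`). -/
abbrev Stmt.stub_doublingIdentity : Prop :=
    ∀ ω₂ lam β γ : ℝ, 0 < ω₂ → 0 < lam → 0 < β → ∀ T : ℝ, 0 < T → ∀ μ : MeasureTheory.Measure Literature.MathematicalPhysics.KineticTheory.HeatConduction.ChainConfig, (Literature.MathematicalPhysics.KineticTheory.HeatConduction.pinnedChain ω₂ lam β γ).IsChainGibbsMeasure T μ → Literature.MathematicalPhysics.KineticTheory.HeatConduction.IsShiftInvariant μ → μ.map (fun σ : Literature.MathematicalPhysics.KineticTheory.HeatConduction.ChainConfig => fun x : ℤ => ((σ x).1, -(σ x).2)) = μ → ∀ D : Literature.MathematicalPhysics.KineticTheory.HeatConduction.InfiniteChainDynamics (Literature.MathematicalPhysics.KineticTheory.HeatConduction.pinnedChain ω₂ lam β γ), D.PreservesMeasure μ → (∀ t : ℝ, ∀ᵐ σ ∂μ, D.flow t (Literature.MathematicalPhysics.KineticTheory.HeatConduction.shift σ) = Literature.MathematicalPhysics.KineticTheory.HeatConduction.shift (D.flow t σ)) →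 ∀ h : Literature.MathematicalPhysics.KineticTheory.HeatConduction.ChainConfig → ℤ → ℝ, h = (fun (σ : Literature.MathematicalPhysics.KineticTheory.HeatConduction.ChainConfig) (x : ℤ) => (σ x).2 ^ 2 / 2 + (Literature.MathematicalPhysics.KineticTheory.HeatConduction.pinnedChain ω₂ lam β γ).U (σ x).1 + ((Literature.MathematicalPhysics.KineticTheory.HeatConduction.pinnedChain ω₂ lam β γ).V ((σ (x + 1)).1 - (σ x).1) + (Literature.MathematicalPhysics.KineticTheory.HeatConduction.pinnedChain ω₂ lam β γ).V ((σ x).1 - (σ (x - 1)).1)) / 2) → ∀ S : ℤ → ℝ → ℝ, S = (fun (x : ℤ) (t : ℝ) => ∫ σ, (h σ 0 - ∫ σ', h σ' 0 ∂μ) * (h (D.flow t σ) x - ∫ σ', h σ' 0 ∂μ) ∂μ) → (∀ ν : ℝ, 0 < ν → MeasureTheory.IntegrableOn (fun t : ℝ => Real.exp (-(ν * t)) * S 0 t) (Set.Ioi 0)) → ∀ (s : ℝ) (L : ℕ) (ap am : ℤ → ℝ), (∀ y ∈ Finset.Icc (-(L:ℤ)) (L:ℤ), S (-y) s = ∑ x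 ∈ Finset.Icc (-(L:ℤ)) (L:ℤ), ap x * S (x - y) 0) → ∫ σ, ((h (D.flow (-s) σ) 0 - ∫ σ', h σ' 0 ∂μ) - ∑ x ∈ Finset.Icc (-(L:ℤ)) (L:ℤ), am x * (h σ x - ∫ σ', h σ' 0 ∂μ)) * ((h (D.flow s σ) 0 - ∫ σ', h σ' 0 ∂μ) - ∑ x ∈ Finset.Icc (-(L:ℤ)) (L:ℤ), ap x * (h σ x - ∫ σ', h σ' 0 ∂μ)) ∂μ = S 0 (2 * s) - ∑ x ∈ Finset.Icc (-(L:ℤ)) (L:ℤ), ap x * S x s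

/-- **stub `stub_debrisRelativeBound` (DYNAMICS, the HARDEST stub, held by the lead; size: open) — the card's `DebrisRelativeBound`, stated on the GENUINE debris object.** There are `0 ≤ c < 2^{-1/2}` and `s₁ > 0` such that for `s ≥ s₁` and all large windows `L`: whenever `Σ apₓh̃ₓ = P_L(h̃₀∘φₛ)` and `Σ amₓh̃ₓ = P_L(h̃₀∘φ₋ₛ)` (both finite normal equations), the debris cross-correlation `R_L(s) = ⟨(1−P_L)(h̃₀∘φ₋ₛ), (1−P_L)(h̃₀∘φₛ)⟩_{L²(μ)}` is at most `c·S(0,s)`. With momentum-reversal invariance `R_L(s) = ‖v_even‖² − ‖v_odd‖²` for `v = (1−P_L)(h̃₀∘φₛ)` (parity imbalance of the non-hydrodynamic part of the evolved local energy). Calibration `R/S(0,s) → 0`, while the trivial bound is `R ≤ S(0,2s) ≈ 2^{-1/2}S(0,s)` — the stub asks exactly to beat the trivial doubling ratio by a fixed margin. MD (card, j025236/j025294): worst late-time ratio +0.22 (anticontinuum), negative where fibre modes are underdamped. -/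
abbrev Stmt.stub_debrisRelativeBound : Prop :=
    ∀ ω₂ lam β γ : ℝ, 0 < ω₂ → 0 < lam → 0 < β → ∀ T : ℝ, 0 < T → ∀ μ : MeasureTheory.Measure Literature.MathematicalPhysics.KineticTheory.HeatConduction.ChainConfig, (Literature.MathematicalPhysics.KineticTheory.HeatConduction.pinnedChain ω₂ lam β γ).IsChainGibbsMeasure T μ → Literature.MathematicalPhysics.KineticTheory.HeatConduction.IsShiftInvariant μ → μ.map (fun σ : Literature.MathematicalPhysics.KineticTheory.HeatConduction.ChainConfig => fun x : ℤ => ((σ x).1, -(σ x).2)) = μ → ∀ D : Literature.MathematicalPhysics.KineticTheory.HeatConduction.InfiniteChainDynamics (Literature.MathematicalPhysics.KineticTheory.HeatConduction.pinnedChain ω₂ lam β γ), D.PreservesMeasure μ → (∀ t : ℝ, ∀ᵐ σ ∂μ, D.flow t (Literature.MathematicalPhysics.KineticTheory.HeatConduction.shift σ) = Literature.MathematicalPhysics.KineticTheory.HeatConduction.shift (D.flow t σ)) → ∀ h : Literature.MathematicalPhysics.KineticTheory.HeatConduction.ChainConfig → ℤ → ℝ, h = (fun (σ : Literature.MathematicalPhysics.KineticTheory.HeatConduction.ChainConfig)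 (x : ℤ) => (σ x).2 ^ 2 / 2 + (Literature.MathematicalPhysics.KineticTheory.HeatConduction.pinnedChain ω₂ lam β γ).U (σ x).1 + ((Literature.MathematicalPhysics.KineticTheory.HeatConduction.pinnedChain ω₂ lam β γ).V ((σ (x + 1)).1 - (σ x).1) + (Literature.MathematicalPhysics.KineticTheory.HeatConduction.pinnedChain ω₂ lam β γ).V ((σ x).1 - (σ (x - 1)).1)) / 2) → ∀ S : ℤ → ℝ → ℝ, S = (fun (x : ℤ) (t : ℝ) => ∫ σ, (h σ 0 - ∫ σ', h σ' 0 ∂μ) * (h (D.flow t σ) x - ∫ σ', h σ' 0 ∂μ) ∂μ) → (∀ ν : ℝ, 0 < ν → MeasureTheory.IntegrableOn (fun t : ℝ => Real.exp (-(ν * t)) * S 0 t) (Set.Ioi 0)) → ∃ c s₁ : ℝ, 0 ≤ c ∧ c < 1 / Real.sqrt 2 ∧ 0 < s₁ ∧ ∀ s : ℝ, s₁ ≤ s → ∃ L₀ : ℕ, ∀ L : ℕ, L₀ ≤ L → ∀ ap am : ℤ → ℝ, (∀ y ∈ Finset.Icc (-(L:ℤ)) (L:ℤ), S (-y) s = ∑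 x ∈ Finset.Icc (-(L:ℤ)) (L:ℤ), ap x * S (x - y) 0) → (∀ y ∈ Finset.Icc (-(L:ℤ)) (L:ℤ), S y s = ∑ x ∈ Finset.Icc (-(L:ℤ)) (L:ℤ), am x * S (x - y) 0) → ∫ σ, ((h (D.flow (-s) σ) 0 - ∫ σ', h σ' 0 ∂μ) - ∑ x ∈ Finset.Icc (-(L:ℤ)) (L:ℤ), am x * (h σ x - ∫ σ', h σ' 0 ∂μ)) * ((h (D.flow s σ) 0 - ∫ σ', h σ' 0 ∂μ) - ∑ x ∈ Finset.Icc (-(L:ℤ)) (L:ℤ), ap x * (h σ x - ∫ σ', h σ' 0 ∂μ)) ∂μ ≤ c * S 0 s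

/-- **stub `stub_pulseMomentGuard` (infrastructure; size L — fixed-time light cone + Gibbs clustering, for EVERY admissible `D`).** The pulse has a summable second moment at every time: `Σₓ (1+x²)|S(x,t)| < ∞`. VERBATIM the summability guard that route CoercivePulse's crux `LinearSpread` (stmt-AtomisticToContinuum-15382) carries as a HYPOTHESIS; K1 has no such guard, so this line must prove it. In tree for the canonical Buttà–Marchioro pair (light cone `InfiniteChainLightCone`, `L²`-locality `InfiniteChainL2Locality`, clustering `InfiniteChainClusteringTransfer`/`InfiniteChainCovarianceMixingBox`); the `∀ D` form needs the a.e. uniqueness bridge (`InfiniteChainUniqueness`). -/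
abbrev Stmt.stub_pulseMomentGuard : Prop :=
    ∀ ω₂ lam β γ : ℝ, 0 < ω₂ → 0 < lam → 0 < β → ∀ T : ℝ, 0 < T → ∀ μ : MeasureTheory.Measure Literature.MathematicalPhysics.KineticTheory.HeatConduction.ChainConfig, (Literature.MathematicalPhysics.KineticTheory.HeatConduction.pinnedChain ω₂ lam β γ).IsChainGibbsMeasure T μ → Literature.MathematicalPhysics.KineticTheory.HeatConduction.IsShiftInvariant μ → μ.map (fun σ : Literature.MathematicalPhysics.KineticTheory.HeatConduction.ChainConfig => fun x : ℤ => ((σ x).1, -(σ x).2)) = μ → ∀ D : Literature.MathematicalPhysics.KineticTheory.HeatConduction.InfiniteChainDynamics (Literature.MathematicalPhysics.KineticTheory.HeatConduction.pinnedChain ω₂ lam β γ), D.PreservesMeasure μ → (∀ t : ℝ, ∀ᵐ σ ∂μ, D.flow t (Literature.MathematicalPhysics.KineticTheory.HeatConduction.shift σ) = Literature.MathematicalPhysics.KineticTheory.HeatConduction.shift (D.flow t σ)) → ∀ h : Literature.MathematicalPhysics.KineticTheory.HeatConduction.ChainConfig → ℤ → ℝ, h = (fun (σ : Literature.MathematicalPhysics.KineticTheory.HeatConduction.ChainConfig)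 (x : ℤ) => (σ x).2 ^ 2 / 2 + (Literature.MathematicalPhysics.KineticTheory.HeatConduction.pinnedChain ω₂ lam β γ).U (σ x).1 + ((Literature.MathematicalPhysics.KineticTheory.HeatConduction.pinnedChain ω₂ lam β γ).V ((σ (x + 1)).1 - (σ x).1) + (Literature.MathematicalPhysics.KineticTheory.HeatConduction.pinnedChain ω₂ lam β γ).V ((σ x).1 - (σ (x - 1)).1)) / 2) → ∀ S : ℤ → ℝ → ℝ, S = (fun (x : ℤ) (t : ℝ) => ∫ σ, (h σ 0 - ∫ σ', h σ' 0 ∂μ) * (h (D.flow t σ) x - ∫ σ', h σ' 0 ∂μ) ∂μ) → (∀ ν : ℝ, 0 < ν → MeasureTheory.IntegrableOn (fun t : ℝ => Real.exp (-(ν * t)) * S 0 t) (Set.Ioi 0)) → ∀ t : ℝ, Summable (fun x : ℤ => (1 + (x : ℝ) ^ 2) * |S x t|)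

/-- **stub `stub_globalCoercivity` (DYNAMICS; open) — VERBATIM the registered stub `stub_globalCoercivity` of crux `CoercivePulse.LinearSpread` (stmt-AtomisticToContinuum-15382, line `birth`; = former route item GlobalCoercivity stmt-15155).** Response coercivity of the equilibrium energy pulse: `∃ t₀, l > 0, A` with `l·Σ(∇S)² ≤ −ΣF∇S`, `Σ|S| ≤ A` (and `Σx²S⁻ = o(t)`, unused here) for `t ≥ t₀`, `F(x,t) = Cov(h₀, jₓ∘φ_t)` the response current. ONE open inequality now serves the rank-2 cruxes of two routes: a proof landed for either skeleton closes this stub by `exact`. -/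
abbrev Stmt.stub_globalCoercivity : Prop :=
    ∀ ω₂ lam β γ : ℝ, 0 < ω₂ → 0 < lam → 0 < β → ∀ T : ℝ, 0 < T → ∀ μ : MeasureTheory.Measure Literature.MathematicalPhysics.KineticTheory.HeatConduction.ChainConfig, (Literature.MathematicalPhysics.KineticTheory.HeatConduction.pinnedChain ω₂ lam β γ).IsChainGibbsMeasure T μ → Literature.MathematicalPhysics.KineticTheory.HeatConduction.IsShiftInvariant μ → μ.map (fun σ : Literature.MathematicalPhysics.KineticTheory.HeatConduction.ChainConfig => fun x : ℤ => ((σ x).1, -(σ x).2)) = μ → ∀ D : Literature.MathematicalPhysics.KineticTheory.HeatConduction.InfiniteChainDynamics (Literature.MathematicalPhysics.KineticTheory.HeatConduction.pinnedChain ω₂ lam β γ), D.PreservesMeasure μ → (∀ t : ℝ, ∀ᵐ σ ∂μ, D.flow t (Literature.MathematicalPhysics.KineticTheory.HeatConduction.shift σ) = Literature.MathematicalPhysics.KineticTheory.HeatConduction.shift (D.flow t σ)) → ∀ h : Literature.MathematicalPhysics.KineticTheory.HeatConduction.ChainConfig → ℤ → ℝ, h = (fun (σ : Literature.MathematicalPhysics.KineticTheory.HeatConduction.ChainConfig)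 (x : ℤ) => (σ x).2 ^ 2 / 2 + (Literature.MathematicalPhysics.KineticTheory.HeatConduction.pinnedChain ω₂ lam β γ).U (σ x).1 + ((Literature.MathematicalPhysics.KineticTheory.HeatConduction.pinnedChain ω₂ lam β γ).V ((σ (x + 1)).1 - (σ x).1) + (Literature.MathematicalPhysics.KineticTheory.HeatConduction.pinnedChain ω₂ lam β γ).V ((σ x).1 - (σ (x - 1)).1)) / 2) → ∀ S : ℤ → ℝ → ℝ, S = (fun (x : ℤ) (t : ℝ) => ∫ σ, (h σ 0 - ∫ σ', h σ' 0 ∂μ) * (h (D.flow t σ) x - ∫ σ', h σ' 0 ∂μ) ∂μ) → ∀ F : ℤ → ℝ → ℝ, F = (fun (x : ℤ) (t : ℝ) => ∫ σ, (h σ 0 - ∫ σ', h σ' 0 ∂μ) * (Literature.MathematicalPhysics.KineticTheory.HeatConduction.pinnedChain ω₂ lam β γ).bondCurrentZ (D.flow t σ) x ∂μ) → ∃ t₀ l A : ℝ, 0 < l ∧ (∀ t : ℝ, t₀ ≤ t → l * ∑' x : ℤ, (S (x + 1) t - S x t) ^ 2 ≤ -∑' x : ℤ, F x t * (S (x + 1)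 t - S x t)) ∧ (∀ t : ℝ, t₀ ≤ t → ∑' x : ℤ, |S x t| ≤ A) ∧ (∀ ε : ℝ, 0 < ε → ∃ t₁ : ℝ, ∀ t : ℝ, t₁ ≤ t → ∑' x : ℤ, (x : ℝ) ^ 2 * max (-S x t) 0 ≤ ε * t)

/-- **stub `stub_pulseDissipationCalculus` (infrastructure; size L) — VERBATIM the registered stub `stub_pulseDissipationCalculus` of crux `CoercivePulse.LinearSpread` (stmt-15382, line `birth`).** Under the guard `Σ(1+x²)|S(·,t)| < ∞`: `F`-summability, `χ = ΣS(·,0) > 0`, conservation, continuity of `t ↦ ΣS²` and `t ↦ ΣF∇S`, and the DISSIPATION IDENTITY `ΣS(t₂)² − ΣS(t₁)² = 2∫_{t₁}^{t₂}ΣF∇S` (`∂ₜS(x) = F(x−1) − F(x)`). -/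
abbrev Stmt.stub_pulseDissipationCalculus : Prop :=
    ∀ ω₂ lam β γ : ℝ, 0 < ω₂ → 0 < lam → 0 < β → ∀ T : ℝ, 0 < T → ∀ μ : MeasureTheory.Measure Literature.MathematicalPhysics.KineticTheory.HeatConduction.ChainConfig, (Literature.MathematicalPhysics.KineticTheory.HeatConduction.pinnedChain ω₂ lam β γ).IsChainGibbsMeasure T μ → Literature.MathematicalPhysics.KineticTheory.HeatConduction.IsShiftInvariant μ → μ.map (fun σ : Literature.MathematicalPhysics.KineticTheory.HeatConduction.ChainConfig => fun x : ℤ => ((σ x).1, -(σ x).2)) = μ → ∀ D : Literature.MathematicalPhysics.KineticTheory.HeatConduction.InfiniteChainDynamics (Literature.MathematicalPhysics.KineticTheory.HeatConduction.pinnedChain ω₂ lam β γ), D.PreservesMeasure μ → (∀ t : ℝ, ∀ᵐ σ ∂μ, D.flow t (Literature.MathematicalPhysics.KineticTheory.HeatConduction.shift σ) = Literature.MathematicalPhysics.KineticTheory.HeatConduction.shift (D.flow t σ)) → ∀ h : Literature.MathematicalPhysics.KineticTheory.HeatConduction.ChainConfig → ℤ → ℝ, h = (fun (σ : Literature.MathematicalPhysics.KineticTheory.HeatConduction.ChainConfig)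 (x : ℤ) => (σ x).2 ^ 2 / 2 + (Literature.MathematicalPhysics.KineticTheory.HeatConduction.pinnedChain ω₂ lam β γ).U (σ x).1 + ((Literature.MathematicalPhysics.KineticTheory.HeatConduction.pinnedChain ω₂ lam β γ).V ((σ (x + 1)).1 - (σ x).1) + (Literature.MathematicalPhysics.KineticTheory.HeatConduction.pinnedChain ω₂ lam β γ).V ((σ x).1 - (σ (x - 1)).1)) / 2) → ∀ S : ℤ → ℝ → ℝ, S = (fun (x : ℤ) (t : ℝ) => ∫ σ, (h σ 0 - ∫ σ', h σ' 0 ∂μ) * (h (D.flow t σ) x - ∫ σ', h σ' 0 ∂μ) ∂μ) → ∀ F : ℤ → ℝ → ℝ, F = (fun (x : ℤ) (t : ℝ) => ∫ σ, (h σ 0 - ∫ σ', h σ' 0 ∂μ) * (Literature.MathematicalPhysics.KineticTheory.HeatConduction.pinnedChain ω₂ lam β γ).bondCurrentZ (D.flow t σ) x ∂μ) → (∀ t : ℝ, Summable (fun x : ℤ => (1 + (x : ℝ) ^ 2) * |S x t|)) → (∀ t : ℝ, Summable (fun x : ℤ => (1 + |(x : ℝ)|) * |F x t|)) ∧ (0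 < ∑' x : ℤ, S x 0) ∧ (∀ t : ℝ, ∑' x : ℤ, S x t = ∑' x : ℤ, S x 0) ∧ Continuous (fun t : ℝ => ∑' x : ℤ, (S x t) ^ 2) ∧ Continuous (fun t : ℝ => ∑' x : ℤ, F x t * (S (x + 1) t - S x t)) ∧ (∀ t₁ t₂ : ℝ, (∑' x : ℤ, (S x t₂) ^ 2) - (∑' x : ℤ, (S x t₁) ^ 2) = 2 * ∫ s in t₁..t₂, ∑' x : ℤ, F x s * (S (x + 1) s - S x s))

/-- **stub `stub_nashL2Decay` (PURE REAL ANALYSIS, provable now; size M) — the ℓ² half of the discrete Nash argument (first half of the planner's proved `NashLowerEnvelope`, stmt-15158, whose exported statement does not expose it).** For any `S F : ℤ → ℝ → ℝ`: summability of `|S(·,t)|`, continuity of `ΣS²` and `ΣF∇S` on `[t₀,∞)`, the dissipation identity, coercivity `l·Σ(∇S)² ≤ −ΣF∇S` and `Σ|S| ≤ A` give `ΣₓS(x,t)² ≤ A²/√(l(t−t₀))` for `t > t₀` (discrete Nash `(Σu²)³ ≤ 4(Σ|u|)⁴Σ(∇u)²` from `‖u‖_∞² ≤ 2‖u‖₂‖∇u‖₂`,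 `‖u‖₂² ≤ ‖u‖_∞‖u‖₁`; then `y = ΣS²` is non-increasing with `y' ≤ −(l/2A⁴)y³`, so `1/y²` grows at rate `≥ l/A⁴`). Reusable verbatim by line `birth` of crux LinearSpread. -/
abbrev Stmt.stub_nashL2Decay : Prop :=
    ∀ (S F : ℤ → ℝ → ℝ) (l A t₀ : ℝ), 0 < l → (∀ t : ℝ, t₀ ≤ t → Summable (fun x : ℤ => |S x t|)) → ContinuousOn (fun t : ℝ => ∑' x : ℤ, (S x t) ^ 2) (Set.Ici t₀) → ContinuousOn (fun t : ℝ => ∑' x : ℤ, F x t * (S (x + 1) t - S x t)) (Set.Ici t₀) → (∀ t₁ t₂ : ℝ, t₀ ≤ t₁ → t₁ ≤ t₂ → (∑' x : ℤ, (S x t₂) ^ 2) - (∑' x : ℤ, (S x t₁) ^ 2) = 2 * ∫ s in t₁..t₂, ∑' x : ℤ, F x s * (S (x + 1) s - S x s)) → (∀ t : ℝ, t₀ ≤ t → l * ∑' x : ℤ, (S (x + 1) t - S x t) ^ 2 ≤ -∑' x : ℤ, F x t * (S (x + 1) t - S x t)) → (∀ t : ℝ, t₀ ≤ t → ∑' x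 : ℤ, |S x t| ≤ A) → ∀ t : ℝ, t₀ < t → Summable (fun x : ℤ => (S x t) ^ 2) ∧ ∑' x : ℤ, (S x t) ^ 2 ≤ A ^ 2 / Real.sqrt (l * (t - t₀))

/-! ## The stubs (landed ones are imported; the ONLY `sorry`s of this file are the active stubs) -/

/-- Registered stub `stub_staticRiesz`: see `Stmt.stub_staticRiesz` — LANDED (p159348), imported from the Theorems file. -/
theorem stub_staticRiesz : Stmt.stub_staticRiesz :=
  _root_.Summit.AtomisticToContinuum.FouriersLaw.Theorems.LocalEnergyHalfHoelder.NashDoubling.stub_staticRiesz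

/-- Registered stub `stub_pulseBounded`: see `Stmt.stub_pulseBounded` — LANDED (p158914), imported from the Theorems file. -/
theorem stub_pulseBounded : Stmt.stub_pulseBounded :=
  _root_.Summit.AtomisticToContinuum.FouriersLaw.Theorems.LocalEnergyHalfHoelder.NashDoubling.stub_pulseBounded

/-- Registered stub `stub_hydroBound`: see `Stmt.stub_hydroBound` — LANDED (p158793), imported from the Theorems file. -/
theorem stub_hydroBound : Stmt.stub_hydroBound :=
  _root_.Summit.AtomisticToContinuum.FouriersLaw.Theorems.LocalEnergyHalfHoelder.NashDoubling.stub_hydroBound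

/-- Registered stub `stub_normalEqSolvable`: see `Stmt.stub_normalEqSolvable` — LANDED (p158724), imported from the Theorems file. -/
theorem stub_normalEqSolvable : Stmt.stub_normalEqSolvable :=
  _root_.Summit.AtomisticToContinuum.FouriersLaw.Theorems.LocalEnergyHalfHoelder.NashDoubling.stub_normalEqSolvable

/-- Registered stub `stub_dyadicAbel`: see `Stmt.stub_dyadicAbel` — LANDED (p158946), imported from the Theorems file. -/
theorem stub_dyadicAbel : Stmt.stub_dyadicAbel :=
  _root_.Summit.AtomisticToContinuum.FouriersLaw.Theorems.LocalEnergyHalfHoelder.NashDoubling.stub_dyadicAbel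

/-- Registered stub `stub_doublingIdentity`: see `Stmt.stub_doublingIdentity` — LANDED (p160767), imported from the Theorems file. -/
theorem stub_doublingIdentity : Stmt.stub_doublingIdentity :=
  _root_.Summit.AtomisticToContinuum.FouriersLaw.Theorems.LocalEnergyHalfHoelder.NashDoubling.stub_doublingIdentity

/-- Registered stub `stub_debrisRelativeBound` (ACTIVE, held by the lead): see `Stmt.stub_debrisRelativeBound`. -/
theorem stub_debrisRelativeBound : Stmt.stub_debrisRelativeBound := by
  sorry

/-- Registered stub `stub_pulseL2Decay` (ACTIVE): see `Stmt.stub_pulseL2Decay`. -/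
theorem stub_pulseL2Decay : Stmt.stub_pulseL2Decay := by
  sorry

/-- Former stub `stub_pulseMomentGuard`: see `Stmt.stub_pulseMomentGuard` — LANDED (p160799), imported from the Theorems file
(now consumed only by the bridge `stub_pulseL2Decay_of_globalCoercivity`). -/
theorem stub_pulseMomentGuard : Stmt.stub_pulseMomentGuard :=
  _root_.Summit.AtomisticToContinuum.FouriersLaw.Theorems.LocalEnergyHalfHoelder.NashDoubling.stub_pulseMomentGuard

/-- Former stub `stub_pulseDissipationCalculus`: see `Stmt.stub_pulseDissipationCalculus` — LANDED (p161707), imported from the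
Theorems file (consumed only by the bridge). -/
theorem stub_pulseDissipationCalculus : Stmt.stub_pulseDissipationCalculus :=
  _root_.Summit.AtomisticToContinuum.FouriersLaw.Theorems.LocalEnergyHalfHoelder.NashDoubling.stub_pulseDissipationCalculus

/-- Former stub `stub_nashL2Decay`: see `Stmt.stub_nashL2Decay` — LANDED (p160715), imported from the Theorems file (consumed
only by the bridge). -/
theorem stub_nashL2Decay : Stmt.stub_nashL2Decay :=
  _root_.Summit.AtomisticToContinuum.FouriersLaw.Theorems.LocalEnergyHalfHoelder.NashDoubling.stub_nashL2Decay

/-! ## The composition (sorry-free) -/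

/-- Reindexing a sum over the symmetric window `[-L, L]` by `x ↦ -x`. -/
theorem sum_Icc_neg_comp (L : ℕ) (g : ℤ → ℝ) :
    ∑ x ∈ Finset.Icc (-(L:ℤ)) (L:ℤ), g (-x) = ∑ x ∈ Finset.Icc (-(L:ℤ)) (L:ℤ), g x := by
  apply Finset.sum_nbij' (fun x => -x) (fun x => -x)
  · intro x hx
    simp only [Finset.mem_Icc] at hx ⊢
    omega
  · intro x hx
    simp only [Finset.mem_Icc] at hx ⊢
    omega
  · intro x _; simp
  · intro x _; simp
  · intro x _; simp

/-- From the Nash `ℓ²` bound `ΣS² ≤ A²/√(l(t−t₀))` (`t > t₀`) to the `B/√t` form on `t ≥ max (2t₀) 1`. -/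
theorem l2_tail_bound {y : ℝ → ℝ} {l A t₀ : ℝ} (hl : 0 < l)
    (hy : ∀ t : ℝ, t₀ < t → y t ≤ A ^ 2 / Real.sqrt (l * (t - t₀))) :
    ∀ t : ℝ, max (2 * t₀) 1 ≤ t → y t ≤ (A ^ 2 / Real.sqrt (l / 2)) / Real.sqrt t := by
  intro t ht
  have ht1 : 1 ≤ t := le_trans (le_max_right _ _) ht
  have ht2 : 2 * t₀ ≤ t := le_trans (le_max_left _ _) ht
  have htpos : 0 < t := by linarith
  have hgt : t₀ < t := by
    rcases le_or_gt t₀ 0 with h0 | h0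
    · linarith
    · linarith
  have hhalf : t / 2 ≤ t - t₀ := by linarith
  have hA2 : 0 ≤ A ^ 2 := sq_nonneg A
  have hs1 : 0 < Real.sqrt (l / 2) * Real.sqrt t := by positivity
  have hle : Real.sqrt (l / 2) * Real.sqrt t ≤ Real.sqrt (l * (t - t₀)) := by
    rw [← Real.sqrt_mul (by positivity)]
    apply Real.sqrt_le_sqrt
    nlinarith
  calc y t ≤ A ^ 2 / Real.sqrt (l * (t - t₀)) := hy t hgt
    _ ≤ A ^ 2 / (Real.sqrt (l / 2) * Real.sqrt t) := div_le_div_of_nonneg_left hA2 hs1 hle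
    _ = (A ^ 2 / Real.sqrt (l / 2)) / Real.sqrt t := by rw [div_div]

/-- **BRIDGE (proved; keeps the sharing with crux LinearSpread stmt-15382).** Response coercivity ⇒ pulse ℓ²-decay:
the LANDED moment guard gives the summability under which the LANDED dissipation calculus supplies continuity of `ΣS²`, of
`ΣF∇S` and the dissipation identity; with the coercivity and `Σ|S| ≤ A` of `stub_globalCoercivity` the LANDED discrete Nash
lemma yields `ΣₓS(x,t)² ≤ A²/√(l(t−t₀))` for `t > t₀`, hence `Σ_{|x|≤L}S(x,t)² ≤ B/√t` for `t ≥ max(2t₀) 1`. So a proof of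
LinearSpread's `stub_globalCoercivity` closes `stub_pulseL2Decay` by `exact stub_pulseL2Decay_of_globalCoercivity GC`. -/
theorem stub_pulseL2Decay_of_globalCoercivity : Stmt.stub_globalCoercivity → Stmt.stub_pulseL2Decay := by
  intro hGC ω₂ lam β γ hω hl hβ T hT μ hG hSI hRefl D hP hShift h hh S hS hInt
  have hSum := stub_pulseMomentGuard ω₂ lam β γ hω hl hβ T hT μ hG hSI hRefl D hP hShift h hh S hS hInt
  obtain ⟨F, hF⟩ : ∃ F : ℤ → ℝ → ℝ, F = (fun (x : ℤ) (t : ℝ) => ∫ σ, (h σ 0 - ∫ σ', h σ' 0 ∂μ) *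
      (Literature.MathematicalPhysics.KineticTheory.HeatConduction.pinnedChain ω₂ lam β γ).bondCurrentZ (D.flow t σ) x ∂μ) :=
    ⟨_, rfl⟩
  obtain ⟨t₀, l, A, hl0, hcoer, hA, -⟩ := hGC ω₂ lam β γ hω hl hβ T hT μ hG hSI hRefl D hP hShift h hh S hS F hF
  obtain ⟨-, -, -, hcS2, hcP, hdiss⟩ :=
    stub_pulseDissipationCalculus ω₂ lam β γ hω hl hβ T hT μ hG hSI hRefl D hP hShift h hh S hS F hF hSum
  have hSabs : ∀ t : ℝ, t₀ ≤ t → Summable (fun x : ℤ => |S x t|) := by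
    intro t _
    refine (hSum t).of_nonneg_of_le (fun x => abs_nonneg _) (fun x => ?_)
    have : 0 ≤ (x : ℝ) ^ 2 * |S x t| := by positivity
    linarith
  have hN := stub_nashL2Decay S F l A t₀ hl0 hSabs hcS2.continuousOn hcP.continuousOn
    (fun t₁ t₂ _ _ => hdiss t₁ t₂) hcoer hA
  refine ⟨A ^ 2 / Real.sqrt (l / 2), max (2 * t₀) 1, lt_of_lt_of_le one_pos (le_max_right _ _), ?_⟩
  intro t ht L
  have htail := l2_tail_bound (y := fun t => ∑' x : ℤ, S x t ^ 2) hl0 (fun t ht' => (hN t ht').2) t ht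
  have hgt : t₀ < t := by
    have ht1 : 1 ≤ t := le_trans (le_max_right _ _) ht
    have ht2 : 2 * t₀ ≤ t := le_trans (le_max_left _ _) ht
    rcases le_or_gt t₀ 0 with h0 | h0 <;> linarith
  have hfin : ∑ x ∈ Finset.Icc (-(L:ℤ)) (L:ℤ), S x t ^ 2 ≤ ∑' x : ℤ, S x t ^ 2 :=
    (hN t hgt).1.sum_le_tsum _ (fun x _ => sq_nonneg _)
  exact hfin.trans htail

/-- **Skeleton theorem — the crux `HoelderEscapeProfile.LocalEnergyHalfHoelder` BY NAME from the eight declared stubs**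
(six landed, two active: `stub_debrisRelativeBound`, `stub_pulseL2Decay`), sorry-free and closed: static Riesz constant
`χ_min = T²/2` → uniform bound `V` → pulse ℓ²-decay `(B, t₁)` → debris ratio `(c, s₁)` → for `s ≥ max s₁ t₁` solve both
finite normal equations, rewrite the debris with the doubling identity, bound the hydrodynamic term by `χ_min⁻¹Σ_{|x|≤L}S²`,
obtain `S(0,2s) ≤ (χ_min⁻¹B)/√s + c·S(0,s)`, and conclude with the dyadic Abelian lemma at `f := S 0`. -/
theorem LocalEnergyHalfHoelder_of :
    Stmt.stub_staticRiesz → Stmt.stub_pulseBounded → Stmt.stub_hydroBound → Stmt.stub_normalEqSolvable →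
    Stmt.stub_dyadicAbel → Stmt.stub_doublingIdentity → Stmt.stub_debrisRelativeBound → Stmt.stub_pulseL2Decay →
    _root_.Summit.AtomisticToContinuum.FouriersLaw.Theses.HoelderEscapeProfile.LocalEnergyHalfHoelder := by
  intro hRiesz hBdd hHyd hSolv hAbel hDI hDeb hL2
    ω₂ lam β γ hω hl hβ T hT μ hG hSI hRefl D hP hShift h hh S hS hInt
  -- the static Riesz constant, the uniform bound, the doubling identity, the debris ratio and the ℓ²-decay at the guarded pair
  have hR := hRiesz ω₂ lam β γ hω hl hβ T hT μ hG hSI hRefl D hP hShift h hh S hS hInt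
  obtain ⟨V, hV⟩ := hBdd ω₂ lam β γ hω hl hβ T hT μ hG hSI hRefl D hP hShift h hh S hS hInt
  have hId := hDI ω₂ lam β γ hω hl hβ T hT μ hG hSI hRefl D hP hShift h hh S hS hInt
  obtain ⟨c, s₁, hc0, hc1, hs₁, hDs⟩ := hDeb ω₂ lam β γ hω hl hβ T hT μ hG hSI hRefl D hP hShift h hh S hS hInt
  obtain ⟨B, t₁, ht₁, hBt⟩ := hL2 ω₂ lam β γ hω hl hβ T hT μ hG hSI hRefl D hP hShift h hh S hS hInt
  have hχ : 0 < T ^ 2 / 2 := by positivity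
  -- the doubling recursion for `f := S 0`
  have hrec : ∀ s : ℝ, max s₁ t₁ ≤ s → S 0 (2 * s) ≤ ((T ^ 2 / 2)⁻¹ * B) / Real.sqrt s + c * S 0 s := by
    intro s hs
    have hs1 : s₁ ≤ s := le_trans (le_max_left _ _) hs
    have hs2 : t₁ ≤ s := le_trans (le_max_right _ _) hs
    obtain ⟨L₀, hL₀⟩ := hDs s hs1
    have hcoer' : ∀ a : ℤ → ℝ, T ^ 2 / 2 * ∑ x ∈ Finset.Icc (-(L₀:ℤ)) (L₀:ℤ), a x ^ 2 ≤
        ∑ x ∈ Finset.Icc (-(L₀:ℤ)) (L₀:ℤ), ∑ y ∈ Finset.Icc (-(L₀:ℤ)) (L₀:ℤ), a x * a y * (fun z => S z 0) (y - x) :=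
      fun a => hR L₀ a
    obtain ⟨ap, hap⟩ := hSolv L₀ (fun z => S z 0) (fun y => S (-y) s) (T ^ 2 / 2) hχ hcoer'
    obtain ⟨am, ham⟩ := hSolv L₀ (fun z => S z 0) (fun y => S y s) (T ^ 2 / 2) hχ hcoer'
    have hsq : ∑ x ∈ Finset.Icc (-(L₀:ℤ)) (L₀:ℤ), (fun x => S x s) x ^ 2 =
        ∑ x ∈ Finset.Icc (-(L₀:ℤ)) (L₀:ℤ), (fun y => S (-y) s) x ^ 2 := by
      simpa using (sum_Icc_neg_comp L₀ (fun x => S x s ^ 2)).symm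
    have hhyd := hHyd L₀ (fun z => S z 0) (fun x => S x s) (fun y => S (-y) s) ap (T ^ 2 / 2) hχ hcoer' hap hsq
    have hap' : ∀ y ∈ Finset.Icc (-(L₀:ℤ)) (L₀:ℤ), S (-y) s = ∑ x ∈ Finset.Icc (-(L₀:ℤ)) (L₀:ℤ), ap x * S (x - y) 0 := by
      simpa using hap
    have ham' : ∀ y ∈ Finset.Icc (-(L₀:ℤ)) (L₀:ℤ), S y s = ∑ x ∈ Finset.Icc (-(L₀:ℤ)) (L₀:ℤ), am x * S (x - y) 0 := by
      simpa using ham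
    have hdeb := hL₀ L₀ le_rfl ap am hap' ham'
    rw [hId s L₀ ap am hap'] at hdeb
    have hl2 := hBt s hs2 L₀
    have hinv : 0 ≤ (T ^ 2 / 2)⁻¹ := inv_nonneg.mpr hχ.le
    have step : (T ^ 2 / 2)⁻¹ * ∑ x ∈ Finset.Icc (-(L₀:ℤ)) (L₀:ℤ), S x s ^ 2 ≤ (T ^ 2 / 2)⁻¹ * (B / Real.sqrt s) :=
      mul_le_mul_of_nonneg_left hl2 hinv
    have hhyd' : ∑ x ∈ Finset.Icc (-(L₀:ℤ)) (L₀:ℤ), ap x * S x s ≤ (T ^ 2 / 2)⁻¹ * ∑ x ∈ Finset.Icc (-(L₀:ℤ)) (L₀:ℤ), S x s ^ 2 := by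
      simpa using hhyd
    have : (T ^ 2 / 2)⁻¹ * (B / Real.sqrt s) = ((T ^ 2 / 2)⁻¹ * B) / Real.sqrt s := by ring
    linarith
  exact hAbel (S 0) V ((T ^ 2 / 2)⁻¹ * B) c (max s₁ t₁) hInt (fun t _ => hV 0 t) hc0 hc1
    (lt_of_lt_of_le hs₁ (le_max_left _ _)) hrec

/-- The former eleven-stub composition (base lead's skeleton, sha 2402f10d) is recovered from the new one through the bridge:
response coercivity in place of the ℓ²-decay. Kept so that the registered stub of crux LinearSpread visibly still closes K1. -/
theorem LocalEnergyHalfHoelder_of_globalCoercivity :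
    Stmt.stub_staticRiesz → Stmt.stub_pulseBounded → Stmt.stub_hydroBound → Stmt.stub_normalEqSolvable →
    Stmt.stub_dyadicAbel → Stmt.stub_doublingIdentity → Stmt.stub_debrisRelativeBound → Stmt.stub_globalCoercivity →
    _root_.Summit.AtomisticToContinuum.FouriersLaw.Theses.HoelderEscapeProfile.LocalEnergyHalfHoelder :=
  fun hRiesz hBdd hHyd hSolv hAbel hDI hDeb hGC =>
    LocalEnergyHalfHoelder_of hRiesz hBdd hHyd hSolv hAbel hDI hDeb (stub_pulseL2Decay_of_globalCoercivity hGC)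

/-- The stubs plug into `LocalEnergyHalfHoelder_of` (type check of the cut; this declaration inherits the two active stubs'
`sorry`s and contains none of its own). -/
theorem LocalEnergyHalfHoelder_skeleton :
    _root_.Summit.AtomisticToContinuum.FouriersLaw.Theses.HoelderEscapeProfile.LocalEnergyHalfHoelder :=
  LocalEnergyHalfHoelder_of stub_staticRiesz stub_pulseBounded stub_hydroBound stub_normalEqSolvable stub_dyadicAbel
    stub_doublingIdentity stub_debrisRelativeBound stub_pulseL2Decay

end NashDoubling

end Summit.AtomisticToContinuum.FouriersLaw.Cruxes.LocalEnergyHalfHoelder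

end
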